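import Literature.MathematicalPhysics.QuantumFieldTheory.Balaban1983to89.B9ResidualEntriesAtOne
import Literature.MathematicalPhysics.QuantumFieldTheory.Balaban1983to89.Node00.OpsYOfLetters

/-!
# `Balaban1983to89.B9ResidualEntriesAtOneAtLetters` — [B9] Cor. 3.5 (p. 407), the RESIDUAL ENTRIES AT U = 1 (`hGp`, `hGA` of the N06 knit)
# AT NODE 00's OPERATOR LAYER OF LETTERS: at `ops := Node00.opsYOfLetters N θ M⋆ 𝔏 𝔈` they are EQUIVALENT to the per-block U = 1 leaves
# ON the operator's summand ALONE — every OFF-summand null reading of `B9ResidualEntriesAtOne` holds by `rfl` at def-Y's readers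

T. Bałaban, *Propagators for lattice gauge theories in a background field*, Commun. Math. Phys. **99** (1985) 389–434
[`Balaban1985BackgroundPropagators`, "B9"]; [4] = T. Bałaban, *Propagators and renormalization transformations for lattice
gauge theories. II*, Commun. Math. Phys. **96** (1984) 223–250 [`Balaban1984PropagatorsII`].

statement-level skeleton of published theorems with citation tags; proofs where landed; nothing here is a claim about the
Yang–Mills mass gap

THE PRINTED LOCUS (verbatim).  Corollary 3.5, p. 407: *"… where we can use the results of [4]. There we have proved these theorems for
operators with the external gauge field configuration U = 1."*; Thm 3.1 (3.43)–(3.47) p. 398.  What [4] does NOT print at U = 1 (cell GAPS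
G-B9-03a, G-B9-20, G-A1-1 (b)): for G′(1) the entries (3.43) with Δ̃-cut-offs, (3.44), (3.45), (3.46), (3.47); for G(1) the entries (3.47) — the
knit `Summit.…N06AtRecord11CB10YZW.b9_main_of_up_view₁₁B10YZW_of_obligations` carries them as the RESIDUAL binders
`hGp : B9FromB6.ResidualGpAtOne geo9Y (bg9Y …) (fun x => (ops x).Gp)` and `hGA : B9FromB6.ResidualGAGlobAtOne geo9Y (bg9Y …) (fun x => (ops x).GA)`
(N06-ASSIGNMENT v1 rows 11–12).

THE POINT.  My g0 file `B9ResidualEntriesAtOne` reduced the two binders, for ANY operator layer over def-Y's signature, to the per-block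
U = 1 leaves ON the operator's summand (`AtOneL2On ∕ AtOneGlobOn ∕ AtOneH1On ∕ AtOneE4On ∕ AtOneH2On` at `P := «site argument»` for G′,
`AtOneGlobOn` at `P := «bond argument»` for G) PLUS the null readings OFF it (`NullOffAtOne`, and for G′'s (3.43) slot the comparison binder
`hGp_h1`).  def-Y's instance (`Node00.OpsYOfLetters`, p464552) reads G′ = `𝔏.Gp` by `kernelFamilyS` ON the site summand and as `0` OFF it, G =
`𝔏.GA` by `kernelFamilyB` ON the bond summand and as `0` OFF it.  THIS FILE kernel-checks that AT THAT LAYER every OFF-summand hypothesis is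
definitional, so rows 11–12 are EQUIVALENT to the ON-summand leaves alone, for every `𝔏`, `𝔈`:

* §1 `nullOffAtOne_Gp_letters` — `NullOffAtOne geo9Y (bg9Y 𝔸 G) (fun x => (operatorLayerYOfLetters 𝔸 G x (𝔏 x) (𝔈 x)).Gp) (fun _ lam => ¬ lam.isRight)`
  (all five slots, incl. (3.43): the `hGp_h1` binder of g0's `hGp_of_blocksOn_of_null` is NOT needed here); `nullOffAtOne_GA_letters` (bond side).
* §2 ★ `residualGpAtOne_letters_of_blocksOn` (ROW 11 ⇐ the five leaves of G′(1) ON SITE ARGUMENTS), ★ `residualGAGlobAtOne_letters_of_globOn`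
  (ROW 12 ⇐ the (3.47) leaf of G(1) ON BOND ARGUMENTS), `residualGAGlobAtOne_letters_of_globMembersOn` (per member n = 0…3), and the
  EQUIVALENCES `residualGpAtOne_letters_iff_blocksOn`, `residualGAGlobAtOne_letters_iff_globOn` (the leaves are necessary too).
* §3 AT THE RECORD `ops := opsYOfLetters N θ M⋆ 𝔏 𝔈`: ★★ `hGp_opsYOfLetters_of_blocksOn`, ★★ `hGA_opsYOfLetters_of_globOn` — conclusions LITERALLY the
  knit binders `hGp` ∕ `hGA` at that `ops`; hypotheses = the ON-summand leaves (printed-shape schemas of g0's file, nothing else).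

HONEST SCOPE.  Bookkeeping: the OFF-summand half of rows 11–12 is discharged at the layer of letters; the ON-summand leaves ARE the cell's
located Literature debt (G-B9-03a ∕ G-B9-20 ∕ G-A1-1 (b); the (3.47) leaf of G′(1) is discharged separately in `B9Ineq347GpAtLetters` from
[4] (2.67) + Lemma 2.1 on the torus).  Nothing of [B9] or [4] is asserted; the letters are NOT constructed (def-Y's successor `lettersYOfRecord`);
count-neutral; N06 NOT discharged; one finite lattice programme — nothing continuum, nothing about the mass gap.  Cell `pub-ymgap` (HUMAN RULING
D-0062), Track A node N06 [B9], N06-ASSIGNMENT v1 rows 11–12 (bundle F3) at def-Y's instance, seat `pub-ymgap-dag-n06-h` (g2), 2026-08-26.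
-/

noncomputable section

namespace Literature.MathematicalPhysics.QuantumFieldTheory.Balaban1983to89.B9ResidualEntriesAtOneAtLetters

open B9FromB6 (ResidualGpAtOne ResidualGAGlobAtOne)
open B9ResidualEntriesAtOne
open B9PinMembersKLevelV1 (MemberY geo9Y bg9Y)
open B9PinCarriersKLevelV1 (OperatorLayerY)
open B7Prop2SpecialUnitary (specialUnitaryUnits)
open Node00

variable {d ℓ : ℕ} {hd : 1 ≤ d + 1} {hL : Odd (ℓ + 1) ∧ 1 < ℓ + 1} {b₀ b₁ : ℝ} {Mstar : ℕ}
variable {𝔸 : Type} [NormedRing 𝔸] [NormedAlgebra ℂ 𝔸] [CompleteSpace 𝔸] {G : Subgroup 𝔸ˣ}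

/-! ## §1 The OFF-summand null readings at the layer of letters are definitional -/

section Null

variable (x : MemberY d ℓ hd hL b₀ b₁ Mstar) (𝔏 : CovLettersY 𝔸 x) (𝔈 : ExpLettersY 𝔸 G x)

/-- on a bond argument every (3.46) quantity of G′'s reading is `≤ 0` (it is `0`), every `U`.
[cite: Balaban1985BackgroundPropagators, Thm 3.1 (3.46) p.398 (λ scalar), bookkeeping] -/
theorem Gp_l2_nonpos_of_isRight (n : Fin 6) (U : (bg9Y 𝔸 G x).Cfg) (lam : (geo9Y x).Loc) (hl : lam.isRight = true) (h : (geo9Y x).Cut) :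
    (operatorLayerYOfLetters 𝔸 G x 𝔏 𝔈).Gp.l2 n U lam h ≤ 0 := by
  cases lam with
  | inl f => exact absurd hl (by simp)
  | inr J => cases h <;> exact le_rfl

/-- on a bond argument every (3.47) quantity of G′'s reading is `≤ 0`, every `U`. [cite: Balaban1985BackgroundPropagators, Thm 3.1 (3.47) p.398 (λ scalar), bookkeeping] -/
theorem Gp_glob_nonpos_of_isRight (n : Fin 4) (U : (bg9Y 𝔸 G x).Cfg) (lam : (geo9Y x).Loc) (hl : lam.isRight = true) (γ : ℝ) :
    (operatorLayerYOfLetters 𝔸 G x 𝔏 𝔈).Gp.glob n U lam γ ≤ 0 := by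
  cases lam with
  | inl f => exact absurd hl (by simp)
  | inr J => exact le_rfl

/-- on a bond argument the (3.43) slot of G′'s reading is `≤ 0`, every `U`, every cut-off. [cite: Balaban1985BackgroundPropagators, Thm 3.1 (3.43) p.398 (λ scalar), bookkeeping] -/
theorem Gp_h1_nonpos_of_isRight (U : (bg9Y 𝔸 G x).Cfg) (lam : (geo9Y x).Loc) (hl : lam.isRight = true) (α : ℝ) (ζ : (geo9Y x).Cut) :
    (operatorLayerYOfLetters 𝔸 G x 𝔏 𝔈).Gp.h1 U lam α ζ ≤ 0 := by
  cases lam with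
  | inl f => exact absurd hl (by simp)
  | inr J => cases ζ <;> exact le_rfl

/-- on a bond argument the (3.44) quantity of G′'s reading is `≤ 0`, every `U`. [cite: Balaban1985BackgroundPropagators, Thm 3.1 (3.44) p.398 (λ scalar), bookkeeping] -/
theorem Gp_e4_nonpos_of_isRight (U : (bg9Y 𝔸 G x).Cfg) (lam : (geo9Y x).Loc) (hl : lam.isRight = true) (y : (geo9Y x).Site) :
    (operatorLayerYOfLetters 𝔸 G x 𝔏 𝔈).Gp.e4 U lam y ≤ 0 := by
  cases lam with
  | inl f => exact absurd hl (by simp)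
  | inr J => exact le_rfl

/-- on a bond argument the (3.45) slot of G′'s reading is `≤ 0`, every `U`, every cut-off. [cite: Balaban1985BackgroundPropagators, Thm 3.1 (3.45) p.398 (λ scalar), bookkeeping] -/
theorem Gp_h2_nonpos_of_isRight (U : (bg9Y 𝔸 G x).Cfg) (lam : (geo9Y x).Loc) (hl : lam.isRight = true) (α : ℝ) (ζ : (geo9Y x).Cut) :
    (operatorLayerYOfLetters 𝔸 G x 𝔏 𝔈).Gp.h2 U lam α ζ ≤ 0 := by
  cases lam with
  | inl f => exact absurd hl (by simp)
  | inr J => cases ζ <;> exact le_rfl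

/-- on a site argument every (3.47) quantity of G's reading is `≤ 0` (it is `0`), every `U`.
[cite: Balaban1985BackgroundPropagators, Thm 3.3 p.399 + (3.47) p.398 (λ vector), bookkeeping] -/
theorem GA_glob_nonpos_of_not_isRight (n : Fin 4) (U : (bg9Y 𝔸 G x).Cfg) (lam : (geo9Y x).Loc) (hl : ¬ (lam.isRight = true)) (γ : ℝ) :
    (operatorLayerYOfLetters 𝔸 G x 𝔏 𝔈).GA.glob n U lam γ ≤ 0 := by
  cases lam with
  | inl f => exact le_rfl
  | inr J => exact absurd rfl hl

/-- on a site argument every (3.46) quantity of G's reading is `≤ 0`, every `U`, every cut-off.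
[cite: Balaban1985BackgroundPropagators, Thm 3.3 p.399 + (3.46) p.398 (λ vector), bookkeeping] -/
theorem GA_l2_nonpos_of_not_isRight (n : Fin 6) (U : (bg9Y 𝔸 G x).Cfg) (lam : (geo9Y x).Loc) (hl : ¬ (lam.isRight = true))
    (h : (geo9Y x).Cut) : (operatorLayerYOfLetters 𝔸 G x 𝔏 𝔈).GA.l2 n U lam h ≤ 0 := by
  cases lam with
  | inl f => cases h <;> exact le_rfl
  | inr J => exact absurd rfl hl

/-- on a site argument the (3.43) slot of G's reading is `≤ 0`, every `U`, every cut-off.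
[cite: Balaban1985BackgroundPropagators, Thm 3.3 p.399 + (3.43) p.398 (λ vector), bookkeeping] -/
theorem GA_h1_nonpos_of_not_isRight (U : (bg9Y 𝔸 G x).Cfg) (lam : (geo9Y x).Loc) (hl : ¬ (lam.isRight = true)) (α : ℝ)
    (ζ : (geo9Y x).Cut) : (operatorLayerYOfLetters 𝔸 G x 𝔏 𝔈).GA.h1 U lam α ζ ≤ 0 := by
  cases lam with
  | inl f => cases ζ <;> exact le_rfl
  | inr J => exact absurd rfl hl

/-- on a site argument the (3.44) quantity of G's reading is `≤ 0`, every `U`. [cite: Balaban1985BackgroundPropagators, Thm 3.3 p.399 + (3.44) p.398 (λ vector), bookkeeping] -/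
theorem GA_e4_nonpos_of_not_isRight (U : (bg9Y 𝔸 G x).Cfg) (lam : (geo9Y x).Loc) (hl : ¬ (lam.isRight = true)) (y : (geo9Y x).Site) :
    (operatorLayerYOfLetters 𝔸 G x 𝔏 𝔈).GA.e4 U lam y ≤ 0 := by
  cases lam with
  | inl f => exact le_rfl
  | inr J => exact absurd rfl hl

/-- on a site argument the (3.45) slot of G's reading is `≤ 0`, every `U`, every cut-off. [cite: Balaban1985BackgroundPropagators, Thm 3.3 p.399 + (3.45) p.398 (λ vector), bookkeeping] -/
theorem GA_h2_nonpos_of_not_isRight (U : (bg9Y 𝔸 G x).Cfg) (lam : (geo9Y x).Loc) (hl : ¬ (lam.isRight = true)) (α : ℝ)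
    (ζ : (geo9Y x).Cut) : (operatorLayerYOfLetters 𝔸 G x 𝔏 𝔈).GA.h2 U lam α ζ ≤ 0 := by
  cases lam with
  | inl f => cases ζ <;> exact le_rfl
  | inr J => exact absurd rfl hl

end Null

section Layer

variable (𝔏 : ∀ x : MemberY d ℓ hd hL b₀ b₁ Mstar, CovLettersY 𝔸 x) (𝔈 : ∀ x : MemberY d ℓ hd hL b₀ b₁ Mstar, ExpLettersY 𝔸 G x)

/-- **`NullOffAtOne` for G′'s reading OFF SITE ARGUMENTS HOLDS at the layer of letters** — all five slots (3.46)∕(3.47)∕(3.43)∕(3.44)∕(3.45) at U = 1,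
for every `𝔏`, `𝔈`. [cite: Balaban1985BackgroundPropagators, Cor. 3.5 p.407 (bookkeeping of the carriers' sum-typed arguments)] -/
theorem nullOffAtOne_Gp_letters :
    NullOffAtOne geo9Y (bg9Y 𝔸 G) (fun x => (operatorLayerYOfLetters 𝔸 G x (𝔏 x) (𝔈 x)).Gp) (fun _ lam => ¬ (lam.isRight = true)) :=
  fun x => ⟨fun n lam h hP => Gp_l2_nonpos_of_isRight x (𝔏 x) (𝔈 x) n _ lam (Classical.not_not.mp hP) h,
    fun n lam γ hP => Gp_glob_nonpos_of_isRight x (𝔏 x) (𝔈 x) n _ lam (Classical.not_not.mp hP) γ,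
    fun lam β ζ hP => Gp_h1_nonpos_of_isRight x (𝔏 x) (𝔈 x) _ lam (Classical.not_not.mp hP) β ζ,
    fun lam y hP => Gp_e4_nonpos_of_isRight x (𝔏 x) (𝔈 x) _ lam (Classical.not_not.mp hP) y,
    fun lam β ζ hP => Gp_h2_nonpos_of_isRight x (𝔏 x) (𝔈 x) _ lam (Classical.not_not.mp hP) β ζ⟩

/-- **`NullOffAtOne` for G's reading OFF BOND ARGUMENTS HOLDS at the layer of letters**, every `𝔏`, `𝔈`.
[cite: Balaban1985BackgroundPropagators, Cor. 3.5 p.407 (bookkeeping of the carriers' sum-typed arguments)] -/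
theorem nullOffAtOne_GA_letters :
    NullOffAtOne geo9Y (bg9Y 𝔸 G) (fun x => (operatorLayerYOfLetters 𝔸 G x (𝔏 x) (𝔈 x)).GA) (fun _ lam => lam.isRight = true) :=
  fun x => ⟨fun n lam h hP => GA_l2_nonpos_of_not_isRight x (𝔏 x) (𝔈 x) n _ lam hP h,
    fun n lam γ hP => GA_glob_nonpos_of_not_isRight x (𝔏 x) (𝔈 x) n _ lam hP γ,
    fun lam β ζ hP => GA_h1_nonpos_of_not_isRight x (𝔏 x) (𝔈 x) _ lam hP β ζ,
    fun lam y hP => GA_e4_nonpos_of_not_isRight x (𝔏 x) (𝔈 x) _ lam hP y,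
    fun lam β ζ hP => GA_h2_nonpos_of_not_isRight x (𝔏 x) (𝔈 x) _ lam hP β ζ⟩

/-! ## §2 Rows 11–12 at the layer of letters ⇔ the ON-summand leaves -/

/-- ★ **ROW `hGp` AT THE LAYER OF LETTERS FROM THE FIVE U = 1 LEAVES OF G′(1) ON SITE ARGUMENTS ALONE** ((3.46), (3.47), (3.43)Δ̃, (3.44), (3.45) —
the printed-shape schemas of `B9ResidualEntriesAtOne`; for G′(1) the cell's G-B9-03a ∕ G-B9-20, not printed in [4]): thresholds and constants merged as
in g0's `residualGpAtOne_of_blocksOn_of_null`, the OFF-summand nulls supplied by §1, signs by dag-n03-b's `modelSignsOn_geo9K`; every `𝔏`, `𝔈`.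
[cite: Balaban1985BackgroundPropagators, Cor. 3.5 p.407 + Thm 3.1 (3.43)–(3.47) p.398] -/
theorem residualGpAtOne_letters_of_blocksOn
    (hL2 : AtOneL2On geo9Y (bg9Y 𝔸 G) (fun x => (operatorLayerYOfLetters 𝔸 G x (𝔏 x) (𝔈 x)).Gp) (fun _ lam => ¬ (lam.isRight = true)))
    (hG : AtOneGlobOn geo9Y (bg9Y 𝔸 G) (fun x => (operatorLayerYOfLetters 𝔸 G x (𝔏 x) (𝔈 x)).Gp) (fun _ lam => ¬ (lam.isRight = true)))
    (hH1 : AtOneH1On geo9Y (bg9Y 𝔸 G) (fun x => (operatorLayerYOfLetters 𝔸 G x (𝔏 x) (𝔈 x)).Gp) (fun _ lam => ¬ (lam.isRight = true)))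
    (hE4 : AtOneE4On geo9Y (bg9Y 𝔸 G) (fun x => (operatorLayerYOfLetters 𝔸 G x (𝔏 x) (𝔈 x)).Gp) (fun _ lam => ¬ (lam.isRight = true)))
    (hH2 : AtOneH2On geo9Y (bg9Y 𝔸 G) (fun x => (operatorLayerYOfLetters 𝔸 G x (𝔏 x) (𝔈 x)).Gp) (fun _ lam => ¬ (lam.isRight = true))) :
    ResidualGpAtOne geo9Y (bg9Y 𝔸 G) (fun x => (operatorLayerYOfLetters 𝔸 G x (𝔏 x) (𝔈 x)).Gp) :=
  residualGpAtOne_of_blocksOn_of_null (fun x => B9GeoNormsKLevelModelSignsV1.modelSignsOn_geo9K x.toKIdx)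
    (nullOffAtOne_Gp_letters 𝔏 𝔈) hL2 hG hH1 hE4 hH2

/-- **ROW `hGp` AT THE LAYER OF LETTERS ⇔ THE FIVE ON-SUMMAND LEAVES** (they are necessary too, g0's projections).
[cite: Balaban1985BackgroundPropagators, Cor. 3.5 p.407 + Thm 3.1 (3.43)–(3.47) p.398 (bookkeeping)] -/
theorem residualGpAtOne_letters_iff_blocksOn :
    ResidualGpAtOne geo9Y (bg9Y 𝔸 G) (fun x => (operatorLayerYOfLetters 𝔸 G x (𝔏 x) (𝔈 x)).Gp) ↔
      AtOneL2On geo9Y (bg9Y 𝔸 G) (fun x => (operatorLayerYOfLetters 𝔸 G x (𝔏 x) (𝔈 x)).Gp) (fun _ lam => ¬ (lam.isRight = true)) ∧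
      AtOneGlobOn geo9Y (bg9Y 𝔸 G) (fun x => (operatorLayerYOfLetters 𝔸 G x (𝔏 x) (𝔈 x)).Gp) (fun _ lam => ¬ (lam.isRight = true)) ∧
      AtOneH1On geo9Y (bg9Y 𝔸 G) (fun x => (operatorLayerYOfLetters 𝔸 G x (𝔏 x) (𝔈 x)).Gp) (fun _ lam => ¬ (lam.isRight = true)) ∧
      AtOneE4On geo9Y (bg9Y 𝔸 G) (fun x => (operatorLayerYOfLetters 𝔸 G x (𝔏 x) (𝔈 x)).Gp) (fun _ lam => ¬ (lam.isRight = true)) ∧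
      AtOneH2On geo9Y (bg9Y 𝔸 G) (fun x => (operatorLayerYOfLetters 𝔸 G x (𝔏 x) (𝔈 x)).Gp) (fun _ lam => ¬ (lam.isRight = true)) :=
  residualGpAtOne_iff_blocksOn (fun x => B9GeoNormsKLevelModelSignsV1.modelSignsOn_geo9K x.toKIdx) (nullOffAtOne_Gp_letters 𝔏 𝔈)

/-- ★ **ROW `hGA` AT THE LAYER OF LETTERS FROM THE (3.47) LEAF OF G(1) ON BOND ARGUMENTS ALONE** (printed-shape schema `AtOneGlobOn`; in print a
consequence of (3.42) for G(1) = [4] (2.136) and [4] Lemma 2.1, G-A1-1 (b)); the site-argument null supplied by §1; every `𝔏`, `𝔈`.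
[cite: Balaban1985BackgroundPropagators, Cor. 3.5 p.407 + (3.47) p.398; Balaban1984PropagatorsII, Prop. 2.6 (2.136) p.247] -/
theorem residualGAGlobAtOne_letters_of_globOn
    (hG : AtOneGlobOn geo9Y (bg9Y 𝔸 G) (fun x => (operatorLayerYOfLetters 𝔸 G x (𝔏 x) (𝔈 x)).GA) (fun _ lam => lam.isRight = true)) :
    ResidualGAGlobAtOne geo9Y (bg9Y 𝔸 G) (fun x => (operatorLayerYOfLetters 𝔸 G x (𝔏 x) (𝔈 x)).GA) :=
  hGA_of_globOn_of_null (fun x => operatorLayerYOfLetters 𝔸 G x (𝔏 x) (𝔈 x))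
    (fun x n lam γ hl => GA_glob_nonpos_of_not_isRight x (𝔏 x) (𝔈 x) n _ lam hl γ) hG

/-- `hGA` at the layer of letters from the four per-member (3.47) leaves of G(1) on bond arguments (|Gλ|_{(2+γ)}, |∇_UGλ|_{(1+γ)}, |G∇*_Uλ|_{(1+γ)},
|Δ_UGλ|_{(γ)}). [cite: Balaban1985BackgroundPropagators, Cor. 3.5 p.407 + (3.47) p.398] -/
theorem residualGAGlobAtOne_letters_of_globMembersOn
    (hG : ∀ n : Fin 4, AtOneGlobnOn geo9Y (bg9Y 𝔸 G) (fun x => (operatorLayerYOfLetters 𝔸 G x (𝔏 x) (𝔈 x)).GA) (fun _ lam => lam.isRight = true) n) :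
    ResidualGAGlobAtOne geo9Y (bg9Y 𝔸 G) (fun x => (operatorLayerYOfLetters 𝔸 G x (𝔏 x) (𝔈 x)).GA) :=
  hGA_of_globMembersOn_of_null (fun x => operatorLayerYOfLetters 𝔸 G x (𝔏 x) (𝔈 x))
    (fun x n lam γ hl => GA_glob_nonpos_of_not_isRight x (𝔏 x) (𝔈 x) n _ lam hl γ) hG

/-- **ROW `hGA` AT THE LAYER OF LETTERS ⇔ THE (3.47) LEAF OF G(1) ON BOND ARGUMENTS.** [cite: Balaban1985BackgroundPropagators, Cor. 3.5 p.407 + (3.47) p.398 (bookkeeping)] -/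
theorem residualGAGlobAtOne_letters_iff_globOn :
    ResidualGAGlobAtOne geo9Y (bg9Y 𝔸 G) (fun x => (operatorLayerYOfLetters 𝔸 G x (𝔏 x) (𝔈 x)).GA) ↔
      AtOneGlobOn geo9Y (bg9Y 𝔸 G) (fun x => (operatorLayerYOfLetters 𝔸 G x (𝔏 x) (𝔈 x)).GA) (fun _ lam => lam.isRight = true) :=
  ⟨atOneGlobOn_of_residualGAGlobAtOne, residualGAGlobAtOne_letters_of_globOn 𝔏 𝔈⟩

/-- likewise for G′: the (3.47) member of `hGp` at the layer is the (3.47) leaf ON site arguments (projection; recorded for the knit's bookkeeping).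
[cite: Balaban1985BackgroundPropagators, (3.47) p.398 (bookkeeping)] -/
theorem atOneGlobOn_Gp_letters_of_residualGpAtOne
    (h : ResidualGpAtOne geo9Y (bg9Y 𝔸 G) (fun x => (operatorLayerYOfLetters 𝔸 G x (𝔏 x) (𝔈 x)).Gp)) :
    AtOneGlobOn geo9Y (bg9Y 𝔸 G) (fun x => (operatorLayerYOfLetters 𝔸 G x (𝔏 x) (𝔈 x)).Gp) (fun _ lam => ¬ (lam.isRight = true)) :=
  atOneGlobOn_of_residualGAGlobAtOne (residualGAGlobAtOne_of_residualGpAtOne h)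

end Layer

/-! ## §3 At the record: the knit binders `hGp`, `hGA` at `ops := opsYOfLetters N θ M⋆ 𝔏 𝔈` -/

section Record

open scoped Matrix.Norms.L2Operator

variable (N : ℕ) (θ : Stage3Params) (Mstar' : ℕ) (𝔏 : LettersY N θ Mstar') (𝔈 : ExpsY N θ Mstar')

/-- ★★ **THE KNIT BINDER `hGp` AT NODE 00's OPERATOR LAYER OF LETTERS FROM THE FIVE U = 1 LEAVES OF G′(1) ON SITE ARGUMENTS** — conclusion LITERALLY
the binder `hGp` of `Summit.…b9_main_of_up_view₁₁B10YZW_of_obligations` at `ops := opsYOfLetters N θ M⋆ 𝔏 𝔈`; hypotheses = the five printed-shape leaves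
(3.46) ∕ (3.47) ∕ (3.43)Δ̃ ∕ (3.44) ∕ (3.45) for G′(1) on site arguments (G-B9-03a ∕ G-B9-20); no null reading, no comparison row.
[cite: Balaban1985BackgroundPropagators, Cor. 3.5 p.407 + Thm 3.1 (3.43)–(3.47) p.398] -/
theorem hGp_opsYOfLetters_of_blocksOn
    (hL2 : AtOneL2On geo9Y (bg9Y (Matrix (Fin N) (Fin N) ℂ) (specialUnitaryUnits (Fin N))) (fun x => (opsYOfLetters N θ Mstar' 𝔏 𝔈 x).Gp)
      (fun _ lam => ¬ (lam.isRight = true)))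
    (hG : AtOneGlobOn geo9Y (bg9Y (Matrix (Fin N) (Fin N) ℂ) (specialUnitaryUnits (Fin N))) (fun x => (opsYOfLetters N θ Mstar' 𝔏 𝔈 x).Gp)
      (fun _ lam => ¬ (lam.isRight = true)))
    (hH1 : AtOneH1On geo9Y (bg9Y (Matrix (Fin N) (Fin N) ℂ) (specialUnitaryUnits (Fin N))) (fun x => (opsYOfLetters N θ Mstar' 𝔏 𝔈 x).Gp)
      (fun _ lam => ¬ (lam.isRight = true)))
    (hE4 : AtOneE4On geo9Y (bg9Y (Matrix (Fin N) (Fin N) ℂ) (specialUnitaryUnits (Fin N))) (fun x => (opsYOfLetters N θ Mstar' 𝔏 𝔈 x).Gp)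
      (fun _ lam => ¬ (lam.isRight = true)))
    (hH2 : AtOneH2On geo9Y (bg9Y (Matrix (Fin N) (Fin N) ℂ) (specialUnitaryUnits (Fin N))) (fun x => (opsYOfLetters N θ Mstar' 𝔏 𝔈 x).Gp)
      (fun _ lam => ¬ (lam.isRight = true))) :
    B9FromB6.ResidualGpAtOne geo9Y (bg9Y (Matrix (Fin N) (Fin N) ℂ) (specialUnitaryUnits (Fin N))) (fun x => (opsYOfLetters N θ Mstar' 𝔏 𝔈 x).Gp) :=
  residualGpAtOne_letters_of_blocksOn 𝔏 𝔈 hL2 hG hH1 hE4 hH2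

/-- ★★ **THE KNIT BINDER `hGA` AT NODE 00's OPERATOR LAYER OF LETTERS FROM THE (3.47) LEAF OF G(1) ON BOND ARGUMENTS** — conclusion LITERALLY the binder
`hGA` at `ops := opsYOfLetters N θ M⋆ 𝔏 𝔈`; hypothesis = the printed-shape (3.47) leaf for G(1) on bond arguments (G-A1-1 (b)); no null reading.
[cite: Balaban1985BackgroundPropagators, Cor. 3.5 p.407 + (3.47) p.398; Balaban1984PropagatorsII, Prop. 2.6 (2.136) p.247] -/
theorem hGA_opsYOfLetters_of_globOn
    (hG : AtOneGlobOn geo9Y (bg9Y (Matrix (Fin N) (Fin N) ℂ) (specialUnitaryUnits (Fin N))) (fun x => (opsYOfLetters N θ Mstar' 𝔏 𝔈 x).GA)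
      (fun _ lam => lam.isRight = true)) :
    B9FromB6.ResidualGAGlobAtOne geo9Y (bg9Y (Matrix (Fin N) (Fin N) ℂ) (specialUnitaryUnits (Fin N))) (fun x => (opsYOfLetters N θ Mstar' 𝔏 𝔈 x).GA) :=
  residualGAGlobAtOne_letters_of_globOn 𝔏 𝔈 hG

/-- `hGA` at the record from the four per-member (3.47) leaves of G(1) on bond arguments. [cite: Balaban1985BackgroundPropagators, Cor. 3.5 p.407 + (3.47) p.398] -/
theorem hGA_opsYOfLetters_of_globMembersOn
    (hG : ∀ n : Fin 4, AtOneGlobnOn geo9Y (bg9Y (Matrix (Fin N) (Fin N) ℂ) (specialUnitaryUnits (Fin N)))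
      (fun x => (opsYOfLetters N θ Mstar' 𝔏 𝔈 x).GA) (fun _ lam => lam.isRight = true) n) :
    B9FromB6.ResidualGAGlobAtOne geo9Y (bg9Y (Matrix (Fin N) (Fin N) ℂ) (specialUnitaryUnits (Fin N))) (fun x => (opsYOfLetters N θ Mstar' 𝔏 𝔈 x).GA) :=
  residualGAGlobAtOne_letters_of_globMembersOn 𝔏 𝔈 hG

/-- at the record, `hGp` ⇔ the five ON-summand leaves. [cite: Balaban1985BackgroundPropagators, Cor. 3.5 p.407 + Thm 3.1 (3.43)–(3.47) p.398 (bookkeeping)] -/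
theorem hGp_opsYOfLetters_iff_blocksOn :
    B9FromB6.ResidualGpAtOne geo9Y (bg9Y (Matrix (Fin N) (Fin N) ℂ) (specialUnitaryUnits (Fin N))) (fun x => (opsYOfLetters N θ Mstar' 𝔏 𝔈 x).Gp) ↔
      AtOneL2On geo9Y (bg9Y (Matrix (Fin N) (Fin N) ℂ) (specialUnitaryUnits (Fin N))) (fun x => (opsYOfLetters N θ Mstar' 𝔏 𝔈 x).Gp)
          (fun _ lam => ¬ (lam.isRight = true)) ∧
        AtOneGlobOn geo9Y (bg9Y (Matrix (Fin N) (Fin N) ℂ) (specialUnitaryUnits (Fin N))) (fun x => (opsYOfLetters N θ Mstar' 𝔏 𝔈 x).Gp)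
          (fun _ lam => ¬ (lam.isRight = true)) ∧
        AtOneH1On geo9Y (bg9Y (Matrix (Fin N) (Fin N) ℂ) (specialUnitaryUnits (Fin N))) (fun x => (opsYOfLetters N θ Mstar' 𝔏 𝔈 x).Gp)
          (fun _ lam => ¬ (lam.isRight = true)) ∧
        AtOneE4On geo9Y (bg9Y (Matrix (Fin N) (Fin N) ℂ) (specialUnitaryUnits (Fin N))) (fun x => (opsYOfLetters N θ Mstar' 𝔏 𝔈 x).Gp)
          (fun _ lam => ¬ (lam.isRight = true)) ∧
        AtOneH2On geo9Y (bg9Y (Matrix (Fin N) (Fin N) ℂ) (specialUnitaryUnits (Fin N))) (fun x => (opsYOfLetters N θ Mstar' 𝔏 𝔈 x).Gp)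
          (fun _ lam => ¬ (lam.isRight = true)) :=
  residualGpAtOne_letters_iff_blocksOn 𝔏 𝔈

/-- at the record, `hGA` ⇔ the (3.47) leaf of G(1) on bond arguments. [cite: Balaban1985BackgroundPropagators, Cor. 3.5 p.407 + (3.47) p.398 (bookkeeping)] -/
theorem hGA_opsYOfLetters_iff_globOn :
    B9FromB6.ResidualGAGlobAtOne geo9Y (bg9Y (Matrix (Fin N) (Fin N) ℂ) (specialUnitaryUnits (Fin N))) (fun x => (opsYOfLetters N θ Mstar' 𝔏 𝔈 x).GA) ↔
      AtOneGlobOn geo9Y (bg9Y (Matrix (Fin N) (Fin N) ℂ) (specialUnitaryUnits (Fin N))) (fun x => (opsYOfLetters N θ Mstar' 𝔏 𝔈 x).GA)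
        (fun _ lam => lam.isRight = true) :=
  residualGAGlobAtOne_letters_iff_globOn 𝔏 𝔈

end Record

end Literature.MathematicalPhysics.QuantumFieldTheory.Balaban1983to89.B9ResidualEntriesAtOneAtLetters

end
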